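import Summits.Ventures.YMGap.Thresholds.QuarterCovarianceFour
import Summits.Ventures.YMGap.SlabAreaLaw
import Summits.QuantumFields.BalabanUV.InfraRed.StrongCouplingQuarterModulusTwoSevenths
import HarnessLib

/-!
# The ball-flux certificate, rung 2/3, capstone: the quarter modulus `OneLinkKRModulusSU2 β_W (1/4)` for every
Wilson `0 ≤ β_W ≤ 2/3`, and the `SU(2)`, `d = 4` AREA LAW for all `0 ≤ β_W < 2/3` modulo the printed Durhuus–Fröhlich
criterion — the ceiling of the quarter-modulus slab door itself (pub-ymgap track (a), A4) — strong-coupling lattice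
statement; no mass-gap claim

HONEST FRAMING. Kernel bookkeeping on top of rung 2/3 (`QuarterCovarianceFour`: pub-balaban's ball-flux method with the
quadratic small-divergence witness of `PolyFluxField` on tilts `3 ≤ κ ≤ 4`, certified by engine-2's two recentred pieces)
and of p1's slab door `Summit.Ventures.YMGap.Slab.su2_hasAreaLaw_of_oneLinkKRModulusSU2` (cell pub-ymgap).  WHAT IS PROVED:
(1) `oneLinkKRModulusSU2_of_le_twoThirds`: for `β_W ≤ 2/3` the one-link Kantorovich–Rubinstein modulus of `SU(2)` with the
floor constant `K₂ = 1/4` on the ball `‖B‖_op ≤ 3β_W/2 ≤ 1` — integration of `quarterCovariance4` along the segment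
`B_t = B + t(B′ − B)`, verbatim as in the tree's `oneLinkKRModulusSU2_of_le_twoSevenths`; (2) `quarterModulusUpTo_twoThirds`;
(3) `su2_hasAreaLaw_lt_twoThirds`: Wilson's AREA LAW `HasAreaLaw 4 (fundamentalRep (Fin 2)) (β_W/2)` for EVERY
`0 ≤ β_W < 2/3`, CONDITIONAL on the named printed fact `durhuusFrohlich_areaLaw_of_slabClustering 4 2` (Durhuus–Fröhlich 1980
as restated by Cao–Nissim–Sheffield 2025, Thm. 2.3; lit-1's Literature fact) — slab Dobrushin constant `6 β_W · (1/4) < 1`,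
which is exactly the door's own ceiling `β_W < 2/3`: with the quarter modulus now available on the whole range the door
admits, this line of the cell is exhausted.  Printed comparison: CNS25 Thm. 1.6 gives the `SU(2)` area law for 't Hooft
`β < 1/24`, i.e. `β_W < 1/6`; the cell's previous kernel ranges were `β_W < 2/7` (p1), `β_W ≤ 1/3`, `β_W ≤ 1/2`
(`QuarterModulusOneThird`, `QuarterModulusOneHalf`); here `β_W < 2/3` (`× 4` the printed threshold), matching the certified
(class C) range of `pub-ymgap-engine-2/A4K-CERT.md` at kernel grade.  NOT CLAIMED: anything at or beyond `β_W = 2/3`;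
nothing about the continuum, the mass gap, or `N ≥ 3`; the area law is a strong-coupling lattice statement and is
conditional on the named printed criterion.
-/

noncomputable section

open MeasureTheory Filter Topology ProbabilityTheory Finset Real
open scoped NNReal Quaternion
open Literature.Probability.LatticeModels
open Literature.MathematicalPhysics.QuantumLattice (fundamentalRep fundamentalLatticeRep quatMatrix su2Quat quatToSU2)
open Literature.MathematicalPhysics.QuantumFieldTheory
open Literature.MathematicalPhysics.QuantumFieldTheory.Balaban1983to89
open Literature.MathematicalPhysics.QuantumFieldTheory.Balaban1983to89.StrongCouplingDobrushinWindow
open Literature.MathematicalPhysics.QuantumFieldTheory.Balaban1983to89.StrongCouplingTorusWindow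
open Literature.MathematicalPhysics.QuantumFieldTheory.Balaban1983to89.StrongCouplingKernelWindow
open Literature.MathematicalPhysics.QuantumFieldTheory.Balaban1983to89.StrongCouplingOpenWindow
open Literature.MathematicalPhysics.QuantumFieldTheory.Balaban1983to89.StrongCouplingVarianceWindow
open Summit.QuantumFields.BalabanUV.InfraRed.StrongCouplingSixFifthsVariance
open Summit.QuantumFields.BalabanUV.InfraRed.StrongCouplingReflection
open Summit.QuantumFields.BalabanUV.InfraRed.StrongCouplingTransverseMoment
open Summit.QuantumFields.BalabanUV.InfraRed.StrongCouplingQuarterCovariance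
open Summit.QuantumFields.BalabanUV.InfraRed.StrongCouplingForestGauge (QuarterModulusUpTo)
open Summit.Ventures.YMGap.QuarterCovarianceFour (quarterCovariance4)

namespace Summit.Ventures.YMGap.QuarterModulusTwoThirds

/-! ## 1. The one-link quarter modulus up to `β_W = 2/3` -/

/-- **The `SU(2)` one-link quarter modulus for `β_W ≤ 2/3`** (`‖B‖_op, ‖B′‖_op ≤ 3β_W/2 ≤ 1`): for every bounded
measurable `L`-Lipschitz `φ`, `|∫ φ dν_B − ∫ φ dν_{B′}| ≤ 4 · (1/4) · L · ‖B − B′‖_F` — integration of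
`quarterCovariance4` along the segment, which stays in the ball `‖B_t‖_op ≤ 1`. [folklore] -/
theorem oneLinkKRModulusSU2_of_le_twoThirds {βW : ℝ} (h12 : βW ≤ 2 / 3) :
    OneLinkKRModulusSU2 βW (1 / 4) := by
  classical
  intro B B' hB hB' φ L hφm hφb hL hφL
  have h2 : ((2 : ℕ) : ℝ) = 2 := by norm_num
  rw [h2, show (4 : ℝ) * (1 / 4) = 1 by norm_num, one_mul]
  set f : Matrix.specialUnitaryGroup (Fin 2) ℂ → ℝ := fun g => (2 : ℝ) * (((g : Matrix (Fin 2) (Fin 2) ℂ) * B).trace.re) with hf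
  set w : Matrix.specialUnitaryGroup (Fin 2) ℂ → ℝ := fun g => (2 : ℝ) * (((g : Matrix (Fin 2) (Fin 2) ℂ) * (B' - B)).trace.re) with hw
  have hfw : (fun g : Matrix.specialUnitaryGroup (Fin 2) ℂ => (2 : ℝ) * (((g : Matrix (Fin 2) (Fin 2) ℂ) * B').trace.re)) = fun g => f g + w g := by
    funext g
    simp only [hf, hw, Matrix.mul_sub, Matrix.trace_sub, Complex.sub_re]
    ring
  rw [hfw, abs_sub_comm]
  have hfm : Measurable f := (continuous_pot B).measurable
  have hwm : Measurable w := (continuous_pot (B' - B)).measurable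
  have hfb : ∃ C, ∀ s, |f s| ≤ C := ⟨_, abs_pot_le B⟩
  have hwb : ∀ s, |w s| ≤ 2 * (Real.sqrt 2 * frobNorm (B' - B)) := abs_pot_le (B' - B)
  have key := abs_integral_tilted_add_sub_le_of_cov (μ := (haarProbability (Matrix.specialUnitaryGroup (Fin 2) ℂ))) (A := L * frobNorm (B' - B)) hfm hfb hwm hwb hφm hφb ?_
  · rw [frobNorm_sub_comm]; exact key
  · intro t ht
    set Bt : Matrix (Fin 2) (Fin 2) ℂ := B + (t : ℂ) • (B' - B) with hBt
    have hft : (fun u : Matrix.specialUnitaryGroup (Fin 2) ℂ => f u + t * w u) = pot Bt := by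
      funext g
      simp only [hf, hw, hBt, pot, Matrix.mul_add, Matrix.mul_smul, Matrix.trace_add, Matrix.trace_smul,
        Complex.add_re, smul_eq_mul, Complex.re_ofReal_mul]
      ring
    have hBt_le : matrixOpNorm Bt ≤ 1 := by
      have h1 : Bt = ((1 - t : ℝ) : ℂ) • B + ((t : ℝ) : ℂ) • B' := by
        rw [hBt]
        push_cast
        simp only [smul_sub, sub_smul, one_smul]
        abel
      rw [h1]
      calc matrixOpNorm (((1 - t : ℝ) : ℂ) • B + ((t : ℝ) : ℂ) • B')
          ≤ matrixOpNorm (((1 - t : ℝ) : ℂ) • B) + matrixOpNorm (((t : ℝ) : ℂ) • B') := matrixOpNorm_add_le _ _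
        _ = (1 - t) * matrixOpNorm B + t * matrixOpNorm B' := by
            rw [matrixOpNorm_smul, matrixOpNorm_smul, Complex.norm_real, Complex.norm_real, Real.norm_eq_abs,
              Real.norm_eq_abs, abs_of_nonneg (by linarith [ht.2]), abs_of_nonneg ht.1]
        _ ≤ (1 - t) * (3 * βW / 2) + t * (3 * βW / 2) :=
            add_le_add (mul_le_mul_of_nonneg_left hB (by linarith [ht.2])) (mul_le_mul_of_nonneg_left hB' ht.1)
        _ ≤ 1 := by linarith
    rw [hft]
    exact quarterCovariance4 Bt (B' - B) hBt_le φ L hφm hφb hL hφL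

/-- The modulus predicate of the forest-gauge line up to `2/3`: `QuarterModulusUpTo (2/3)` (every `0 ≤ β_W < 2/3`). [folklore] -/
theorem quarterModulusUpTo_twoThirds : QuarterModulusUpTo (2 / 3) := fun _ _ hlt =>
  oneLinkKRModulusSU2_of_le_twoThirds hlt.le

/-! ## 2. The `SU(2)`, `d = 4` area law for `β_W < 2/3`, modulo the printed slab criterion -/

/-- **`SU(2)` AREA LAW FOR ALL `0 ≤ β_W < 2/3`, `d = 4`** (tree coupling `β_W/2`), CONDITIONAL on the named printed fact
`durhuusFrohlich_areaLaw_of_slabClustering 4 2` (Durhuus–Fröhlich 1980, Thms. 1.2–1.3, as restated and used by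
Cao–Nissim–Sheffield 2025, Thm. 2.3): p1's slab door `su2_hasAreaLaw_of_oneLinkKRModulusSU2` fed with the quarter
modulus of §1 (slab Dobrushin constant `6 · β_W · (1/4) < 1`, the door's own ceiling).  Printed area-law threshold:
`β_W < 1/6` (CNS25 Thm. 1.6); previous kernel range in the tree: `β_W ≤ 1/2`.  Strong-coupling lattice statement only.
[cite: CaoNissimSheffield2025dynamical, Theorems 1.6 and 2.3] -/
theorem su2_hasAreaLaw_lt_twoThirds (h : durhuusFrohlich_areaLaw_of_slabClustering 4 2) {βW : ℝ}
    (hβ : 0 ≤ βW) (hlt : βW < 2 / 3) : HasAreaLaw 4 (fundamentalRep (Fin 2)) (βW / 2) :=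
  Summit.Ventures.YMGap.Slab.su2_hasAreaLaw_of_oneLinkKRModulusSU2 h hβ (by norm_num)
    (oneLinkKRModulusSU2_of_le_twoThirds hlt.le) (by nlinarith)

/-- Instance at `β_W = 13/20` (`× 3.9` the printed `1/6`): the area law, modulo the named printed criterion. [folklore] -/
theorem su2_hasAreaLaw_thirteenTwentieths (h : durhuusFrohlich_areaLaw_of_slabClustering 4 2) :
    HasAreaLaw 4 (fundamentalRep (Fin 2)) ((13 / 20 : ℝ) / 2) :=
  su2_hasAreaLaw_lt_twoThirds h (by norm_num) (by norm_num)

end Summit.Ventures.YMGap.QuarterModulusTwoThirds
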